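import Literature.RingTheory.JacobsonRadical.VonNeumannRegularRings
import Mathlib.LinearAlgebra.Pi
import Mathlib.LinearAlgebra.Basis.Basic
import Mathlib.LinearAlgebra.Span.Basic
import HarnessLib

/-!
# Lam §6 Exercise 6.19: over a von Neumann regular ring, finitely generated submodules of finitely generated free modules are
# direct summands

[cite: Lam2001FirstCourse, §6 Exercise 6.19, p. 99]

Lam, *A First Course in Noncommutative Rings*, Exercises for §6 (p. 99; p0111 of the held scan):

**Ex. 6.19.** For any von Neumann regular ring `k`, show that any finitely generated submodule `M` of a projective `k`-module `P` is a
direct summand of `P` (and hence also a projective `k`-module). (**Hint.** Reduce to the case where `P` is a free module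
`e₁k ⊕ ⋯ ⊕ eₙk`. Map `M` to `eₙk` by coordinate projection, and induct on `n`.)

This file proves the free case of finite rank, for LEFT modules (Lam writes right modules; von Neumann regularity is left-right
symmetric, (4.23)), following the hint: the coordinate projection `π : k × V → k` maps `M` onto a finitely generated left ideal
`π(M) = ke` (`e² = e`, by (4.23) in the tree's `forall_exists_mul_mul_self_iff_fg`); with `m₀ = e·m₁ ∈ M`, `π(m₁) = e`, one has
`M = (M ∩ ker π) ⊕ k m₀`, `M ∩ ker π = ψ(M)` finitely generated for `ψ(m) = m − π(m)m₀`, a complement `C` of it in `V = ker π` by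
induction, and then `C ⊕ k(1 − e, 0)` is a complement of `M` (`exists_isCompl_of_fg_prod`). Induction on `n` along
`k × kⁿ ≅ kⁿ⁺¹` gives the result for `kⁿ` (`exists_isCompl_of_fg_pi`) and for every module with a finite basis
(`exists_isCompl_of_fg_of_basis`). «von Neumann regular» is spelled `∀ a, ∃ x, a * x * a = a` as in `VonNeumannRegularRings`.
-- TODO(general form): `P` an arbitrary projective module (reduce to a free module of possibly infinite rank, where a finitely
-- generated submodule lies in a finite-rank free direct summand).

## References

* [Lam2001FirstCourse] T. Y. Lam, *A First Course in Noncommutative Rings*, 2nd ed., Graduate Texts in Mathematics 131, Springer, 2001,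
  §6 Exercise 6.19, p. 99 (held scan `book:lamnd-first-course-noncommutative-rings`, p0111); §4 Thm. (4.23).
-/

universe u v v'

namespace Literature.RingTheory.JacobsonRadical

variable {k : Type u} [Ring k]

/-! ## §1 Transport along linear equivalences; the case `P = k` -/

/-- The property «every finitely generated submodule is a direct summand» is invariant under linear isomorphism («Reduce to the case where
`P` is a free module»). [cite: Lam2001FirstCourse, §6 Exercise 6.19 (Hint)] -/
theorem forall_fg_exists_isCompl_of_linearEquiv {V : Type v} {W : Type v'} [AddCommGroup V] [Module k V] [AddCommGroup W] [Module k W]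
    (e : V ≃ₗ[k] W) (h : ∀ M : Submodule k V, M.FG → ∃ N, IsCompl M N) (M : Submodule k W) (hM : M.FG) : ∃ N, IsCompl M N := by
  obtain ⟨N', hN'⟩ := h (M.map (e.symm : W →ₗ[k] V)) (hM.map _)
  refine ⟨N'.map (e : V →ₗ[k] W), ?_⟩
  have h1 : (M.map (e.symm : W →ₗ[k] V)).map (e : V →ₗ[k] W) = M := by
    rw [← Submodule.map_comp]
    convert Submodule.map_id M
    ext x
    simp
  rw [← h1]
  exact (Submodule.orderIsoMapComap e).isCompl_iff.1 hN'

/-- **The case `P = k`**: over a von Neumann regular ring every finitely generated left ideal is a direct summand ((4.23)).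
[cite: Lam2001FirstCourse, §4 Thm. (4.23); §6 Exercise 6.19] -/
theorem exists_isCompl_of_fg_self (hR : ∀ a : k, ∃ x, a * x * a = a) (I : Submodule k k) (hI : I.FG) : ∃ J, IsCompl I J :=
  forall_exists_mul_mul_self_iff_fg_isCompl.1 hR I hI

/-! ## §2 The inductive step `V ⟶ k × V` (Lam's hint) -/

/-- **Lam's inductive step.** If every finitely generated submodule of `V` is a direct summand and `k` is von Neumann regular, then every
finitely generated submodule `M` of `k × V` is a direct summand: with `π : k × V → k` the coordinate projection, `π(M) = ke` for an
idempotent `e`, `M = (M ∩ ker π) ⊕ k·m₀` (`m₀ = e m₁`, `π(m₁) = e`), and a complement of `M ∩ ker π ⊆ V` plus `k·(1 − e, 0)` is a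
complement of `M`. [cite: Lam2001FirstCourse, §6 Exercise 6.19 (Hint)] -/
theorem exists_isCompl_of_fg_prod (hR : ∀ a : k, ∃ x, a * x * a = a) {V : Type v} [AddCommGroup V] [Module k V]
    (hV : ∀ M : Submodule k V, M.FG → ∃ N, IsCompl M N) (M : Submodule k (k × V)) (hM : M.FG) : ∃ N, IsCompl M N := by
  classical
  -- `π(M) = ke`, `e` idempotent
  obtain ⟨e, he, hI⟩ := (forall_exists_mul_mul_self_iff_fg.1 hR) (M.map (LinearMap.fst k k V)) (hM.map _)
  have heI : e ∈ M.map (LinearMap.fst k k V) := by rw [hI]; exact Ideal.mem_span_singleton_self e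
  obtain ⟨m₁, hm₁M, hm₁⟩ := Submodule.mem_map.1 heI
  rw [LinearMap.fst_apply] at hm₁
  -- `m₀ = e m₁ ∈ M`, `π(m₀) = e`
  set m₀ : k × V := e • m₁ with hm₀def
  have hm₀M : m₀ ∈ M := M.smul_mem e hm₁M
  have hm₀fst : m₀.1 = e := by rw [hm₀def, Prod.smul_fst, hm₁, smul_eq_mul, he.eq]
  -- every `m ∈ M` has `π(m) e = π(m)`
  have hfst : ∀ m ∈ M, m.1 * e = m.1 := fun m hm ↦ by
    have h1 : m.1 ∈ Ideal.span ({e} : Set k) := hI ▸ Submodule.mem_map_of_mem hm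
    obtain ⟨a, ha⟩ := Ideal.mem_span_singleton'.1 h1
    rw [← ha, mul_assoc, he.eq]
  -- `ψ(m) = m − π(m) m₀` maps `M` onto `M ∩ ker π`
  let ψ : (k × V) →ₗ[k] (k × V) := LinearMap.id - (LinearMap.fst k k V).smulRight m₀
  have hψ : ∀ m : k × V, ψ m = m - m.1 • m₀ := fun m ↦ rfl
  have hψM : ∀ m ∈ M, ψ m ∈ M := fun m hm ↦ by rw [hψ]; exact sub_mem hm (M.smul_mem _ hm₀M)
  have hψfst : ∀ m ∈ M, (ψ m).1 = 0 := fun m hm ↦ by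
    rw [hψ, Prod.fst_sub, Prod.smul_fst, hm₀fst, smul_eq_mul, hfst m hm, sub_self]
  have hψeq : ∀ m ∈ M, ψ m = LinearMap.inr k k V (ψ m).2 := fun m hm ↦
    Prod.ext (by rw [LinearMap.inr_apply, hψfst m hm]) (by rw [LinearMap.inr_apply])
  -- a complement `C` of `M₁' = snd(ψ(M)) ⊆ V`
  obtain ⟨C, hC⟩ := hV ((M.map ψ).map (LinearMap.snd k k V)) ((hM.map _).map _)
  refine ⟨C.map (LinearMap.inr k k V) ⊔ k ∙ ((1 - e, 0) : k × V), ⟨?_, ?_⟩⟩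
  · -- disjointness
    rw [Submodule.disjoint_def]
    intro x hxM hxN
    obtain ⟨y, hy, z, hz, rfl⟩ := Submodule.mem_sup.1 hxN
    obtain ⟨c, hc, rfl⟩ := Submodule.mem_map.1 hy
    obtain ⟨a, rfl⟩ := Submodule.mem_span_singleton.1 hz
    -- `π(x) = a(1 − e) ∈ ke` forces `a(1 − e) = 0`
    have h1 : (LinearMap.inr k k V c + a • ((1 - e, 0) : k × V)).1 = a * (1 - e) := by
      rw [Prod.fst_add, LinearMap.inr_apply, Prod.smul_fst, smul_eq_mul, zero_add]
    have h2 := hfst _ hxM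
    rw [h1] at h2
    have h3 : a * (1 - e) = 0 := by rw [← h2, mul_assoc, sub_mul, one_mul, he.eq, sub_self, mul_zero]
    have hz0 : a • ((1 - e, 0) : k × V) = 0 := Prod.ext (by rw [Prod.smul_fst, smul_eq_mul, h3, Prod.fst_zero])
      (by rw [Prod.smul_snd, smul_zero, Prod.snd_zero])
    rw [hz0, add_zero] at hxM ⊢
    -- so `x = (0, c) ∈ M ∩ ker π = ψ(M)`, whence `c ∈ M₁' ∩ C = 0`
    have hψx : ψ (LinearMap.inr k k V c) = LinearMap.inr k k V c := by
      rw [hψ, LinearMap.inr_apply, zero_smul, sub_zero]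
    have hcM : c ∈ (M.map ψ).map (LinearMap.snd k k V) :=
      ⟨LinearMap.inr k k V c, ⟨LinearMap.inr k k V c, hxM, hψx⟩, rfl⟩
    rw [(Submodule.disjoint_def.1 hC.disjoint) c hcM hc, map_zero]
  · -- `M + N = k × V`
    rw [codisjoint_iff, eq_top_iff]
    rintro ⟨a, v⟩ -
    set S : Submodule k (k × V) := M ⊔ (C.map (LinearMap.inr k k V) ⊔ k ∙ ((1 - e, 0) : k × V)) with hS
    -- (i) `(0, w) ∈ S` for every `w`
    have hinr : ∀ w : V, LinearMap.inr k k V w ∈ S := fun w ↦ by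
      have hw : w ∈ (M.map ψ).map (LinearMap.snd k k V) ⊔ C := by rw [codisjoint_iff.1 hC.codisjoint]; exact Submodule.mem_top
      obtain ⟨w₁, hw₁, c, hc, rfl⟩ := Submodule.mem_sup.1 hw
      rw [map_add]
      refine add_mem ?_ (Submodule.mem_sup_right (Submodule.mem_sup_left ⟨c, hc, rfl⟩))
      obtain ⟨y, ⟨m, hm, rfl⟩, rfl⟩ := hw₁
      rw [LinearMap.snd_apply, ← hψeq m hm]
      exact Submodule.mem_sup_left (hψM m hm)
    -- (ii) `(e, 0) = m₀ − (0, m₀.2) ∈ S`, (iii) `(1 − e, 0) ∈ S`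
    have he0 : ((e, 0) : k × V) ∈ S := by
      have h1 : ((e, 0) : k × V) = m₀ - LinearMap.inr k k V m₀.2 :=
        Prod.ext (by rw [Prod.fst_sub, LinearMap.inr_apply, hm₀fst, sub_zero]) (by rw [Prod.snd_sub, LinearMap.inr_apply, sub_self])
      rw [h1]
      exact sub_mem (Submodule.mem_sup_left hm₀M) (hinr _)
    have h1e : ((1 - e, 0) : k × V) ∈ S := Submodule.mem_sup_right (Submodule.mem_sup_right (Submodule.mem_span_singleton_self _))
    -- `(a, v) = a(e, 0) + a(1 − e, 0) + (0, v)`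
    have hav : ((a, v) : k × V) = a • ((e, 0) : k × V) + a • ((1 - e, 0) : k × V) + LinearMap.inr k k V v :=
      Prod.ext (by simp [mul_sub]) (by simp)
    rw [hav]
    exact add_mem (add_mem (S.smul_mem a he0) (S.smul_mem a h1e)) (hinr v)

/-! ## §3 Exercise 6.19 for `kⁿ` and for modules with a finite basis -/

/-- **LAM Exercise 6.19 for `P = kⁿ`: over a von Neumann regular ring every finitely generated submodule of `kⁿ` is a direct summand.**
[cite: Lam2001FirstCourse, §6 Exercise 6.19] -/
theorem exists_isCompl_of_fg_pi (hR : ∀ a : k, ∃ x, a * x * a = a) :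
    ∀ (n : ℕ) (M : Submodule k (Fin n → k)), M.FG → ∃ N, IsCompl M N
  | 0 => fun M _ ↦ ⟨⊤, by
      have hM : M = ⊥ := by
        rw [eq_bot_iff]
        intro x _
        rw [Submodule.mem_bot, Subsingleton.elim x 0]
      rw [hM]
      exact isCompl_bot_top⟩
  | n + 1 => forall_fg_exists_isCompl_of_linearEquiv (Fin.consLinearEquiv k fun _ : Fin (n + 1) ↦ k)
      (exists_isCompl_of_fg_prod hR (exists_isCompl_of_fg_pi hR n))

/-- **LAM Exercise 6.19 for a free module with a finite basis: over a von Neumann regular ring `k`, every finitely generated submodule of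
a `k`-module with a finite basis is a direct summand** (hence projective). [cite: Lam2001FirstCourse, §6 Exercise 6.19] -/
theorem exists_isCompl_of_fg_of_basis (hR : ∀ a : k, ∃ x, a * x * a = a) {V : Type v} [AddCommGroup V] [Module k V] {ι : Type*}
    [Finite ι] (b : Module.Basis ι k V) (M : Submodule k V) (hM : M.FG) : ∃ N, IsCompl M N := by
  haveI := Fintype.ofFinite ι
  exact forall_fg_exists_isCompl_of_linearEquiv ((b.reindex (Fintype.equivFin ι)).equivFun.symm)
    (exists_isCompl_of_fg_pi hR (Fintype.card ι)) M hM

end Literature.RingTheory.JacobsonRadical
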